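import Literature.Probability.LatticeModels.DiluteA22Weights
import Mathlib.Analysis.Calculus.Deriv.MeanValue
import Mathlib.Analysis.Calculus.Deriv.Shift
import Mathlib.Analysis.Convex.SpecificFunctions.Basic
import Mathlib.Analysis.SpecialFunctions.Trigonometric.Deriv
import Mathlib.Analysis.SpecialFunctions.Sqrt
import HarnessLib

/-!
# Venture YMGap — Conjectures/ChiralClockTransmission.lean: the SINGLE-EDGE TRANSMISSION LEMMA (C1) behind the typed conjecture
# `ChiralClockComparison` — real analysis of the three-term clock sum `F_a(φ) = Σ_{k<3} e^{a cos(φ + 2πk/3)}`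

HONEST FRAMING (venture `Summits/Ventures/YMGap`, cell `pub-ymgap`, track Y2 ROBUST-BALL, seat ds-4 g14).  Elementary real analysis, theorems
plus ONE auxiliary definition (`clockSum`); nothing about gauge fields, limits or the Clay problem.  The conjecture (C) `ChiralClockComparison`
(file `Conjectures/ChiralClockComparison.lean`; the one open point of the centre-blind `β`-ladder for odd `N`) compares the two-point
function of the `ℤ₃` clock model with complex couplings `a e^{iφ}` to the ferromagnet with the same moduli.  On ONE edge it reads
`|ĉ_φ(1)|/ĉ_φ(0) ≤ ĉ_0(1)/ĉ_0(0)` for the Fourier coefficients `ĉ_φ(m) = (1/3)Σ_k e^{a cos(2πk/3 + φ)} e^{−2πikm/3}` of the edge weight —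
lemma (C1) of the dossier `HOME/ds/ds4/SUBCRITICAL-LAYER.md` §8g (there a desk proof).  This file makes (C1) a kernel theorem:

* `clockSum a φ = e^{a cos φ} + e^{a cos(φ+2π/3)} + e^{a cos(φ+4π/3)} = 3ĉ_φ(0)` is even (`clockSum_neg`), `2π/3`-periodic
  (`clockSum_periodic`) and, for `a ≥ 0`, ANTITONE on `[0, π/3]` (`clockSum_antitoneOn`): its derivative is `−a Σ_k sin ψ_k e^{a cos ψ_k}`,
  `ψ_k = φ + 2πk/3`, and `Σ_k sin ψ_k e^{a cos ψ_k} ≥ 0` on `(0, π/3)` (`clockSum_deriv_sign`) by comparing the two secant slopes of the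
  convex `t ↦ e^{at}` at `cos ψ₁ < cos ψ₂ < cos ψ₀` through the identity `sin ψ₀ (cos ψ₀ − cos ψ₂) = sin ψ₁ (cos ψ₂ − cos ψ₁)`;
  hence `2e^{a/2} + e^{−a} = F_a(π/3) ≤ F_a(φ) ≤ F_a(0) = e^a + 2e^{−a/2}` for EVERY `φ` (`clockSum_pi_div_three_le_and_le_zero`);
* the three weights multiply to `1` (`Σ_k cos ψ_k = 0`), so their second elementary symmetric function is `F_a(φ + π/3)`
  (`clockSum_add_pi_div_three`) and `9|ĉ_φ(1)|² = F_a(φ)² − 3F_a(φ+π/3)`;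
* **(C1) `transmission_sq_le`**: `(F_a(φ)² − 3F_a(φ+π/3))·F_a(0)² ≤ (e^a − e^{−a/2})²·F_a(φ)²` (`a ≥ 0`), i.e.
  `|ĉ_φ(1)|/ĉ_φ(0) ≤ (e^a − e^{−a/2})/(e^a + 2e^{−a/2}) = ĉ_0(1)/ĉ_0(0)` — a chiral phase can only LOWER the single-edge transmission;
* `transmission_mono`: the ferromagnetic transmission `(e^A − e^{−A/2})/(e^A + 2e^{−A/2})` is non-decreasing in the coupling `A`.
The sequel `Conjectures/ChiralClockComparisonSingleEdge.lean` turns this into (C) on `n ≤ 2` vertices.  References: G. Mack, V. B. Petkova,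
Ann. Phys. 123 (1979) 442 (the `ℤ₂` mechanism this generalises) [cite: MackPetkova1979, §2]; J. Ginibre, Commun. Math. Phys. 16 (1970) 310.
-/

noncomputable section

open Real

namespace Summit.Ventures.YMGap.Conjectures

/-! ### The three-term sum `F_a(φ) = Σ_{k<3} exp(a cos(φ + 2πk/3))` -/

/-- The three-term clock sum `F_a(φ) = e^{a cos φ} + e^{a cos(φ + 2π/3)} + e^{a cos(φ + 4π/3)}` (= `3 ĉ_φ(0)`, three times the
zeroth Fourier coefficient of the chiral single-edge weight `m ↦ e^{a cos(2πm/3 + φ)}` on `ℤ₃`). [folklore] -/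
def clockSum (a φ : ℝ) : ℝ :=
  exp (a * cos φ) + exp (a * cos (φ + 2 * π / 3)) + exp (a * cos (φ + 4 * π / 3))

open Literature.Probability.LatticeModels.DiluteA22 (cos_two_pi_div_three sin_two_pi_div_three)

/-- `cos(4π/3) = −1/2`. [folklore] -/
theorem cos_four_pi_div_three : cos (4 * π / 3) = -1 / 2 := by
  have : 4 * π / 3 = π / 3 + π := by ring
  rw [this, cos_add_pi, cos_pi_div_three]; ring

/-- `sin(4π/3) = −√3/2`. [folklore] -/
theorem sin_four_pi_div_three : sin (4 * π / 3) = -(√3 / 2) := by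
  have : 4 * π / 3 = π / 3 + π := by ring
  rw [this, sin_add_pi, sin_pi_div_three]

/-- `cos(φ + 2π/3) = -cos φ/2 - (√3/2) sin φ`. [folklore] -/
theorem cos_add_two_pi_div_three (φ : ℝ) : cos (φ + 2 * π / 3) = -(1 / 2) * cos φ - √3 / 2 * sin φ := by
  rw [cos_add, cos_two_pi_div_three, sin_two_pi_div_three]; ring

/-- `cos(φ + 4π/3) = -cos φ/2 + (√3/2) sin φ`. [folklore] -/
theorem cos_add_four_pi_div_three (φ : ℝ) : cos (φ + 4 * π / 3) = -(1 / 2) * cos φ + √3 / 2 * sin φ := by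
  rw [cos_add, cos_four_pi_div_three, sin_four_pi_div_three]; ring

/-- `sin(φ + 2π/3) = -sin φ/2 + (√3/2) cos φ`. [folklore] -/
theorem sin_add_two_pi_div_three (φ : ℝ) : sin (φ + 2 * π / 3) = -(1 / 2) * sin φ + √3 / 2 * cos φ := by
  rw [sin_add, cos_two_pi_div_three, sin_two_pi_div_three]; ring

/-- `sin(φ + 4π/3) = -sin φ/2 - (√3/2) cos φ`. [folklore] -/
theorem sin_add_four_pi_div_three (φ : ℝ) : sin (φ + 4 * π / 3) = -(1 / 2) * sin φ - √3 / 2 * cos φ := by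
  rw [sin_add, cos_four_pi_div_three, sin_four_pi_div_three]; ring

/-- The three cosines sum to zero: `cos φ + cos(φ + 2π/3) + cos(φ + 4π/3) = 0`. [folklore] -/
theorem cos_three_sum (φ : ℝ) : cos φ + cos (φ + 2 * π / 3) + cos (φ + 4 * π / 3) = 0 := by
  rw [cos_add_two_pi_div_three, cos_add_four_pi_div_three]; ring

/-- `F_a` has period `2π/3`. [folklore] -/
theorem clockSum_add_period (a φ : ℝ) : clockSum a (φ + 2 * π / 3) = clockSum a φ := by
  unfold clockSum
  have h1 : φ + 2 * π / 3 + 2 * π / 3 = φ + 4 * π / 3 := by ring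
  have h2 : φ + 2 * π / 3 + 4 * π / 3 = φ + 2 * π := by ring
  rw [h1, h2, cos_add_two_pi]; ring

/-- `F_a` is `2π/3`-periodic. [folklore] -/
theorem clockSum_periodic (a : ℝ) : Function.Periodic (clockSum a) (2 * π / 3) := fun φ => clockSum_add_period a φ

/-- `F_a` is even. [folklore] -/
theorem clockSum_neg (a φ : ℝ) : clockSum a (-φ) = clockSum a φ := by
  unfold clockSum
  have h1 : -φ + 2 * π / 3 = -(φ + 4 * π / 3) + 2 * π := by ring
  have h2 : -φ + 4 * π / 3 = -(φ + 2 * π / 3) + 2 * π := by ring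
  rw [h1, h2, cos_add_two_pi, cos_add_two_pi, cos_neg, cos_neg, cos_neg]; ring

/-- `F_a(0) = e^a + 2e^{-a/2}`. [folklore] -/
theorem clockSum_zero (a : ℝ) : clockSum a 0 = exp a + 2 * exp (-(a / 2)) := by
  unfold clockSum
  rw [zero_add, zero_add, cos_zero, cos_two_pi_div_three, cos_four_pi_div_three]
  have : a * (-1 / 2) = -(a / 2) := by ring
  rw [mul_one, this]; ring

/-- `F_a(π/3) = 2e^{a/2} + e^{-a}`. [folklore] -/
theorem clockSum_pi_div_three (a : ℝ) : clockSum a (π / 3) = 2 * exp (a / 2) + exp (-a) := by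
  unfold clockSum
  have h1 : π / 3 + 2 * π / 3 = π := by ring
  have h2 : π / 3 + 4 * π / 3 = -(π / 3) + 2 * π := by ring
  rw [h1, h2, cos_add_two_pi, cos_neg, cos_pi, cos_pi_div_three]
  have : a * (1 / 2) = a / 2 := by ring
  rw [this, mul_neg_one]; ring

/-- `F_a > 0`. [folklore] -/
theorem clockSum_pos (a φ : ℝ) : 0 < clockSum a φ := by
  unfold clockSum; positivity

/-- The derivative of `F_a`. [folklore] -/
theorem hasDerivAt_clockSum (a φ : ℝ) :
    HasDerivAt (clockSum a) (-(a * (sin φ * exp (a * cos φ) + sin (φ + 2 * π / 3) * exp (a * cos (φ + 2 * π / 3)) +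
      sin (φ + 4 * π / 3) * exp (a * cos (φ + 4 * π / 3))))) φ := by
  have h0 : HasDerivAt (fun ψ => exp (a * cos ψ)) (exp (a * cos φ) * (a * -sin φ)) φ :=
    ((hasDerivAt_cos φ).const_mul a).exp
  have h1 : HasDerivAt (fun ψ => exp (a * cos (ψ + 2 * π / 3)))
      (exp (a * cos (φ + 2 * π / 3)) * (a * -sin (φ + 2 * π / 3))) φ :=
    (((hasDerivAt_cos (φ + 2 * π / 3)).comp_add_const φ (2 * π / 3)).const_mul a).exp
  have h2 : HasDerivAt (fun ψ => exp (a * cos (ψ + 4 * π / 3)))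
      (exp (a * cos (φ + 4 * π / 3)) * (a * -sin (φ + 4 * π / 3))) φ :=
    (((hasDerivAt_cos (φ + 4 * π / 3)).comp_add_const φ (4 * π / 3)).const_mul a).exp
  show HasDerivAt (fun ψ => exp (a * cos ψ) + exp (a * cos (ψ + 2 * π / 3)) + exp (a * cos (ψ + 4 * π / 3))) _ φ
  refine ((h0.add h1).add h2).congr_deriv ?_
  ring

/-- **KEY SIGN.** For `a ≥ 0` and `φ ∈ (0, π/3)`: `sin φ·e^{a cos φ} + sin(φ+2π/3)·e^{a cos(φ+2π/3)} + sin(φ+4π/3)·e^{a cos(φ+4π/3)} ≥ 0`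
(secant slopes of the convex `t ↦ e^{at}` at `cos(φ+2π/3) < cos(φ+4π/3) < cos φ`, and the identity
`sin φ·(cos φ − cos(φ+4π/3)) = sin(φ+2π/3)·(cos(φ+4π/3) − cos(φ+2π/3))`). [folklore] -/
theorem clockSum_deriv_sign {a φ : ℝ} (ha : 0 ≤ a) (h0 : 0 < φ) (h1 : φ < π / 3) :
    0 ≤ sin φ * exp (a * cos φ) + sin (φ + 2 * π / 3) * exp (a * cos (φ + 2 * π / 3)) +
      sin (φ + 4 * π / 3) * exp (a * cos (φ + 4 * π / 3)) := by
  -- notation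
  set c0 := cos φ with hc0
  set c1 := cos (φ + 2 * π / 3) with hc1
  set c2 := cos (φ + 4 * π / 3) with hc2
  set s0 := sin φ with hs0
  set s1 := sin (φ + 2 * π / 3) with hs1
  have hs2 : sin (φ + 4 * π / 3) = -(s0 + s1) := by
    rw [sin_add_four_pi_div_three, hs1, sin_add_two_pi_div_three]; ring
  have h3 : (0 : ℝ) < √3 := Real.sqrt_pos.2 (by norm_num)
  have h33 : √3 * √3 = 3 := Real.mul_self_sqrt (by norm_num)
  have hφπ : φ < π := by linarith [pi_pos]
  have hs0p : 0 < s0 := sin_pos_of_pos_of_lt_pi h0 hφπ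
  have hcos : 1 / 2 < c0 := by
    rw [hc0, ← cos_pi_div_three]
    exact cos_lt_cos_of_nonneg_of_le_pi_div_two (le_of_lt h0) (by linarith [pi_pos]) h1
  have hsin : s0 < √3 / 2 := by
    rw [hs0, ← sin_pi_div_three]
    exact sin_lt_sin_of_lt_of_le_pi_div_two (by linarith [pi_pos]) (by linarith [pi_pos]) h1
  have hs1p : 0 < s1 := by
    rw [hs1, sin_add_two_pi_div_three, ← hs0, ← hc0]
    nlinarith
  have hc21 : c1 < c2 := by
    rw [hc1, hc2, cos_add_two_pi_div_three, cos_add_four_pi_div_three, ← hs0, ← hc0]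
    nlinarith
  have hc02 : c2 < c0 := by
    rw [hc2, cos_add_four_pi_div_three, ← hs0, ← hc0]
    nlinarith
  -- the identity  s0 (c0 - c2) = s1 (c2 - c1)
  have hid : s0 * (c0 - c2) = s1 * (c2 - c1) := by
    rw [hc1, hc2, hs1, cos_add_two_pi_div_three, cos_add_four_pi_div_three, sin_add_two_pi_div_three, ← hs0, ← hc0]
    linear_combination (-(1 / 2) * s0 * c0) * h33
  -- secant slopes of t ↦ exp (a t)
  have hslope : (exp (a * c2) - exp (a * c1)) / (c2 - c1) ≤ (exp (a * c0) - exp (a * c2)) / (c0 - c2) := by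
    rcases eq_or_lt_of_le ha with rfl | ha'
    · simp
    have key := convexOn_exp.slope_mono_adjacent (x := a * c1) (y := a * c2) (z := a * c0) (Set.mem_univ _)
      (Set.mem_univ _) (mul_lt_mul_of_pos_left hc21 ha') (mul_lt_mul_of_pos_left hc02 ha')
    rw [← mul_sub, ← mul_sub, div_mul_eq_div_div_swap, div_mul_eq_div_div_swap] at key
    · have := mul_le_mul_of_nonneg_left key ha'.le
      rwa [mul_div_cancel₀ _ ha'.ne', mul_div_cancel₀ _ ha'.ne'] at this
  have hK : 0 ≤ s0 * (c0 - c2) := mul_nonneg hs0p.le (by linarith)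
  -- conclude
  have hd02 : 0 < c0 - c2 := by linarith
  have hd21 : 0 < c2 - c1 := by linarith
  rw [hs2]
  have e1 : s0 * exp (a * c0) + s1 * exp (a * c1) + -(s0 + s1) * exp (a * c2) =
      s0 * (c0 - c2) * ((exp (a * c0) - exp (a * c2)) / (c0 - c2)) -
        s1 * (c2 - c1) * ((exp (a * c2) - exp (a * c1)) / (c2 - c1)) := by
    field_simp
    ring
  rw [e1, ← hid, ← mul_sub]
  exact mul_nonneg hK (by linarith)

/-- `F_a` is antitone on `[0, π/3]` (`a ≥ 0`). [folklore] -/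
theorem clockSum_antitoneOn {a : ℝ} (ha : 0 ≤ a) : AntitoneOn (clockSum a) (Set.Icc 0 (π / 3)) := by
  have hd : ∀ ψ, HasDerivAt (clockSum a) _ ψ := hasDerivAt_clockSum a
  refine antitoneOn_of_deriv_nonpos (convex_Icc _ _) (fun ψ _ => (hd ψ).continuousAt.continuousWithinAt)
    (fun ψ _ => (hd ψ).differentiableAt.differentiableWithinAt) fun ψ hψ => ?_
  rw [interior_Icc] at hψ
  rw [(hd ψ).deriv]
  have := clockSum_deriv_sign ha hψ.1 hψ.2
  nlinarith

/-- **`F_a(φ) ≤ F_a(0)` and `F_a(π/3) ≤ F_a(φ)` for every `φ`** (`a ≥ 0`; reduce `φ` to `[0, 2π/3)` by periodicity, to `[0, π/3]` by evenness,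
then use monotonicity). [folklore] -/
theorem clockSum_pi_div_three_le_and_le_zero {a : ℝ} (ha : 0 ≤ a) (φ : ℝ) :
    clockSum a (π / 3) ≤ clockSum a φ ∧ clockSum a φ ≤ clockSum a 0 := by
  have hper := clockSum_periodic a
  have hc : 0 < 2 * π / 3 := by positivity
  obtain ⟨y, ⟨hy0, hy1⟩, hφy⟩ := hper.exists_mem_Ico₀ hc φ
  rw [hφy]
  have hanti := clockSum_antitoneOn ha
  have h0mem : (0 : ℝ) ∈ Set.Icc 0 (π / 3) := ⟨le_rfl, by positivity⟩
  have h3mem : π / 3 ∈ Set.Icc 0 (π / 3) := ⟨by positivity, le_rfl⟩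
  by_cases hy : y ≤ π / 3
  · have hymem : y ∈ Set.Icc 0 (π / 3) := ⟨hy0, hy⟩
    exact ⟨hanti hymem h3mem hy, hanti h0mem hymem hy0⟩
  · rw [not_le] at hy
    -- reflect: F(y) = F(y - 2π/3) = F(2π/3 - y)
    have hy' : clockSum a y = clockSum a (2 * π / 3 - y) := by
      rw [← clockSum_neg a (2 * π / 3 - y), neg_sub, ← hper (y - 2 * π / 3), sub_add_cancel]
    rw [hy']
    have hmem : 2 * π / 3 - y ∈ Set.Icc 0 (π / 3) := ⟨by linarith, by linarith⟩
    exact ⟨hanti hmem h3mem hmem.2, hanti h0mem hmem hmem.1⟩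

/-- `F_a(φ) ≤ F_a(0) = e^a + 2e^{-a/2}` (`a ≥ 0`). [folklore] -/
theorem clockSum_le_zero {a : ℝ} (ha : 0 ≤ a) (φ : ℝ) : clockSum a φ ≤ clockSum a 0 :=
  (clockSum_pi_div_three_le_and_le_zero ha φ).2

/-- `F_a(π/3) = 2e^{a/2} + e^{-a} ≤ F_a(φ)` (`a ≥ 0`). [folklore] -/
theorem clockSum_pi_div_three_le {a : ℝ} (ha : 0 ≤ a) (φ : ℝ) : clockSum a (π / 3) ≤ clockSum a φ :=
  (clockSum_pi_div_three_le_and_le_zero ha φ).1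

/-- The product of the three single-edge weights is `1`: `e^{a cos φ} e^{a cos(φ+2π/3)} e^{a cos(φ+4π/3)} = 1`, so the second elementary
symmetric function of the weights is `F_a(φ + π/3)`:
`e^{a cos φ}e^{a cos(φ+2π/3)} + e^{a cos φ}e^{a cos(φ+4π/3)} + e^{a cos(φ+2π/3)}e^{a cos(φ+4π/3)} = F_a(φ + π/3)`. [folklore] -/
theorem clockSum_add_pi_div_three (a φ : ℝ) :
    clockSum a (φ + π / 3) = exp (a * cos φ) * exp (a * cos (φ + 2 * π / 3)) + exp (a * cos φ) * exp (a * cos (φ + 4 * π / 3)) +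
      exp (a * cos (φ + 2 * π / 3)) * exp (a * cos (φ + 4 * π / 3)) := by
  unfold clockSum
  have e1 : φ + π / 3 = (φ + 4 * π / 3) - π := by ring
  have e2 : φ + π / 3 + 2 * π / 3 = φ + π := by ring
  have e3 : φ + π / 3 + 4 * π / 3 = (φ + 2 * π / 3) + π := by ring
  rw [e2, e3, e1, cos_sub_pi, cos_add_pi, cos_add_pi, ← exp_add, ← exp_add, ← exp_add]
  have hs := cos_three_sum φ
  have t1 : a * -cos (φ + 4 * π / 3) = a * cos φ + a * cos (φ + 2 * π / 3) := by linear_combination (-a) * hs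
  have t2 : a * -cos φ = a * cos (φ + 2 * π / 3) + a * cos (φ + 4 * π / 3) := by linear_combination (-a) * hs
  have t3 : a * -cos (φ + 2 * π / 3) = a * cos φ + a * cos (φ + 4 * π / 3) := by linear_combination (-a) * hs
  rw [t1, t2, t3]; ring

/-- **THE TRANSMISSION LEMMA (C1) in polynomial form.** With `x_k = e^{a cos(φ + 2πk/3)}` (`a ≥ 0`), the squared modulus of the first
Fourier coefficient `|Σ_k x_k ω^k|² = Σ x_k² − Σ_{i<j} x_ix_j = F_a(φ)² − 3F_a(φ+π/3)` and `(Σ x_k)² = F_a(φ)²` satisfy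
`(F_a(φ)² − 3F_a(φ+π/3))·F_a(0)² ≤ (F_a(0)² − 3F_a(π/3))·F_a(φ)²`, i.e. `|ĉ_φ(1)|/ĉ_φ(0) ≤ ĉ_0(1)/ĉ_0(0)`; and
`F_a(0)² − 3F_a(π/3) = (e^a − e^{−a/2})²`. [folklore] -/
theorem transmission_sq_le {a : ℝ} (ha : 0 ≤ a) (φ : ℝ) :
    (clockSum a φ ^ 2 - 3 * clockSum a (φ + π / 3)) * clockSum a 0 ^ 2 ≤ (exp a - exp (-(a / 2))) ^ 2 * clockSum a φ ^ 2 := by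
  have h1 := clockSum_le_zero ha φ
  have h2 := clockSum_pi_div_three_le ha (φ + π / 3)
  have hp := clockSum_pos a φ
  have hp0 := clockSum_pos a 0
  have hkey : (exp a - exp (-(a / 2))) ^ 2 = clockSum a 0 ^ 2 - 3 * clockSum a (π / 3) := by
    rw [clockSum_zero, clockSum_pi_div_three]
    have e1 : exp a = exp (a / 2) * exp (a / 2) := by rw [← exp_add]; ring_nf
    have e2 : exp (-(a / 2)) * exp (a / 2) = 1 := by rw [← exp_add]; simp
    have e3 : exp (-a) = exp (-(a / 2)) * exp (-(a / 2)) := by rw [← exp_add]; ring_nf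
    rw [e1, e3]
    linear_combination (-6 * exp (a / 2)) * e2
  rw [hkey]
  have hsq : clockSum a φ ^ 2 ≤ clockSum a 0 ^ 2 := pow_le_pow_left₀ hp.le h1 2
  nlinarith [mul_le_mul h2 hsq (by positivity) (clockSum_pos a _).le]

/-- `r(A) = (e^A − e^{−A/2})/(e^A + 2e^{−A/2})` (the ferromagnetic transmission `ĉ_0(1)/ĉ_0(0)` at coupling `A`) is non-decreasing on `[0, ∞)`,
in cross-multiplied form. [folklore] -/
theorem transmission_mono {A B : ℝ} (hAB : A ≤ B) :
    (exp A - exp (-(A / 2))) * (exp B + 2 * exp (-(B / 2))) ≤ (exp B - exp (-(B / 2))) * (exp A + 2 * exp (-(A / 2))) := by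
  have h := exp_le_exp.2 (show A - B / 2 ≤ B - A / 2 by linarith)
  have e1 : exp A * exp (-(B / 2)) = exp (A - B / 2) := by rw [← exp_add]; ring_nf
  have e2 : exp B * exp (-(A / 2)) = exp (B - A / 2) := by rw [← exp_add]; ring_nf
  nlinarith [e1, e2, h]

end Summit.Ventures.YMGap.Conjectures

end
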